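import Summits.QuantumAdvantage.QuantumAdvantage.Theorems.LinnikCubicClassGroupsDegreeOnePrimesEscapeClassFunctionPNT
import HarnessLib

/-!
# The Chebotarev prime number theorem in the Linnik range for complex class functions (characters)

Topic `Summits/QuantumAdvantage/QuantumAdvantage/Theorems`, cell B2b-1 (linnik-cubic), PART A (gen 14);
helper toward the crux `DegreeOnePrimesEscape` (stmt-QuantumAdvantage-11543) of route
`LinnikCubicClassGroups`.  HONEST FRAMING: the value of this file is a THEOREM (kernel-checked, GRH-free,
Siegel-free, no hypothesis) — NOT summit progress.

`classFunction_PNT` for complex-valued class functions `φ : Gal(N/ℚ) → ℂ` (e.g. characters of complex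
representations — prime sums of traces of Frobenius of Artin representations), by taking real and
imaginary parts:

  `‖Σ_{p ≤ x, p ∤ d_N} φ(Fr p) − (Σ_g φ(g) Li(x) − θ Σ_g φ(g)χ₁(g) Li(x^{β₁}))/|G|‖`
  `≤ 2ε · Σ_g ‖φ(g)‖ · (Li(x) + θ Li(x^{β₁})) / |G|`     (`x ≥ |d_N|^L`).
[cite: LagariasMontgomeryOdlyzko1979, Theorem 1.1]
-/

noncomputable section

open scoped NumberField nonZeroDivisors
open Finset Real Ideal NumberField
open Literature.NumberTheory.NumberFields Literature.NumberTheory.LFunctions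
  Literature.NumberTheory.LFunctions.NumberField

namespace Summit.QuantumAdvantage.QuantumAdvantage.Theorems.DegreeOnePrimesEscape

set_option maxHeartbeats 4000000 in
open scoped Classical in
/-- **The Chebotarev prime number theorem in the Linnik range for complex class functions** (see the
module docstring).  Unconditional. [cite: LagariasMontgomeryOdlyzko1979, Theorem 1.1] -/
theorem classFunction_PNT_complex (n : ℕ) (hn : 1 < n) {ε : ℝ} (hε : 0 < ε) (hε1 : ε ≤ 1) :
    ∃ L c : ℝ, 0 < L ∧ 0 < c ∧ c ≤ 1 / 4 ∧ ∀ (N : Type) [Field N] [NumberField N] [IsGalois ℚ N],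
      Module.finrank ℚ N = n →
      ∃ (θ β₁ : ℝ) (K₁ : Subgroup (N ≃ₐ[ℚ] N)), (θ = 0 ∨ θ = 1) ∧ K₁.Normal ∧
        1 - c / (Real.log ((NumberField.discr N).natAbs : ℝ) + Real.log 4) < β₁ ∧ β₁ < 1 ∧
        (θ = 1 → dedekindZeta₁ N β₁ = 0 ∧ K₁.index = 2 ∧
          ∀ H : Subgroup (N ≃ₐ[ℚ] N),
            dedekindZeta₁ (IntermediateField.fixedField H) β₁ = 0 ↔ H ≤ K₁) ∧
        (θ = 0 → K₁ = ⊤ ∧ ¬ ∃ β : ℝ, dedekindZeta₁ N β = 0 ∧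
          1 - c / (Real.log ((NumberField.discr N).natAbs : ℝ) + Real.log 4) < β ∧ β < 1) ∧
        ∀ φ : (N ≃ₐ[ℚ] N) → ℂ, (∀ g h : N ≃ₐ[ℚ] N, φ (h * g * h⁻¹) = φ g) →
        ∀ Fr : ℕ → (N ≃ₐ[ℚ] N),
          (∀ p : ℕ, p.Prime → ¬ ((p : ℤ) ∣ NumberField.discr N) →
            ∃ (Q : Ideal (𝓞 N)) (_ : Q.IsMaximal) (_ : Q.LiesOver (span {(p : ℤ)})),
              IsArithFrobAt ℤ (Fr p) Q ∧ Q.inertia (N ≃ₐ[ℚ] N) = ⊥) →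
          ∀ x : ℝ, ((NumberField.discr N).natAbs : ℝ) ^ L ≤ x →
            ‖(∑ p ∈ (Nat.primesLE ⌊x⌋₊).filter (fun p : ℕ => ¬ ((p : ℤ) ∣ NumberField.discr N)),
                φ (Fr p)) -
              ((∑ g : N ≃ₐ[ℚ] N, φ g) * (offsetLogIntegral x : ℂ) -
                (θ : ℂ) * (∑ g : N ≃ₐ[ℚ] N, φ g * (if g ∈ K₁ then (1 : ℂ) else -1)) *
                  (offsetLogIntegral (x ^ β₁) : ℂ)) / (Nat.card (N ≃ₐ[ℚ] N) : ℂ)‖ ≤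
              2 * ε * ((∑ g : N ≃ₐ[ℚ] N, ‖φ g‖) * (offsetLogIntegral x + θ * offsetLogIntegral (x ^ β₁)) /
                Nat.card (N ≃ₐ[ℚ] N)) := by
  obtain ⟨L, c, hL, hc, hc4, h⟩ := classFunction_PNT n hn hε hε1
  refine ⟨L, c, hL, hc, hc4, fun N _ _ _ hN => ?_⟩
  obtain ⟨θ, β₁, K₁, hθ, hK₁n, hβ₁c, hβ₁1, h1, h0, hS⟩ := h N hN
  refine ⟨θ, β₁, K₁, hθ, hK₁n, hβ₁c, hβ₁1, h1, h0, fun φ hφ Fr hFr x hx => ?_⟩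
  -- real and imaginary parts are real class functions
  have hre := hS (fun g => (φ g).re) (fun g h' => by simp only [hφ]) Fr hFr x hx
  have him := hS (fun g => (φ g).im) (fun g h' => by simp only [hφ]) Fr hFr x hx
  set s := (Nat.primesLE ⌊x⌋₊).filter (fun p : ℕ => ¬ ((p : ℤ) ∣ NumberField.discr N)) with hs
  set E : ℂ := (∑ p ∈ s, φ (Fr p)) -
    ((∑ g : N ≃ₐ[ℚ] N, φ g) * (offsetLogIntegral x : ℂ) -
      (θ : ℂ) * (∑ g : N ≃ₐ[ℚ] N, φ g * (if g ∈ K₁ then (1 : ℂ) else -1)) *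
        (offsetLogIntegral (x ^ β₁) : ℂ)) / (Nat.card (N ≃ₐ[ℚ] N) : ℂ) with hE
  -- the real part of `E`
  have hEre : E.re = (∑ p ∈ s, (φ (Fr p)).re) -
      ((∑ g : N ≃ₐ[ℚ] N, (φ g).re) * offsetLogIntegral x -
        θ * (∑ g : N ≃ₐ[ℚ] N, (φ g).re * (if g ∈ K₁ then (1 : ℝ) else -1)) *
          offsetLogIntegral (x ^ β₁)) / Nat.card (N ≃ₐ[ℚ] N) := by
    have hχ : ∀ g : N ≃ₐ[ℚ] N, (φ g * (if g ∈ K₁ then (1 : ℂ) else -1)).re =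
        (φ g).re * (if g ∈ K₁ then (1 : ℝ) else -1) := by
      intro g; split_ifs <;> simp
    rw [hE, Complex.sub_re, Complex.div_natCast_re, Complex.sub_re, Complex.re_sum,
      Complex.mul_re, Complex.ofReal_re, Complex.ofReal_im, mul_zero, sub_zero, Complex.re_sum]
    congr 2
    rw [Complex.mul_re, Complex.ofReal_re, Complex.ofReal_im, mul_zero, sub_zero, Complex.mul_re,
      Complex.ofReal_re, Complex.ofReal_im, zero_mul, sub_zero, Complex.re_sum]
    simp_rw [hχ]
  have hEim : E.im = (∑ p ∈ s, (φ (Fr p)).im) -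
      ((∑ g : N ≃ₐ[ℚ] N, (φ g).im) * offsetLogIntegral x -
        θ * (∑ g : N ≃ₐ[ℚ] N, (φ g).im * (if g ∈ K₁ then (1 : ℝ) else -1)) *
          offsetLogIntegral (x ^ β₁)) / Nat.card (N ≃ₐ[ℚ] N) := by
    have hχ : ∀ g : N ≃ₐ[ℚ] N, (φ g * (if g ∈ K₁ then (1 : ℂ) else -1)).im =
        (φ g).im * (if g ∈ K₁ then (1 : ℝ) else -1) := by
      intro g; split_ifs <;> simp
    rw [hE, Complex.sub_im, Complex.div_natCast_im, Complex.sub_im, Complex.im_sum,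
      Complex.mul_im, Complex.ofReal_re, Complex.ofReal_im, mul_zero, zero_add, Complex.im_sum]
    congr 2
    rw [Complex.mul_im, Complex.ofReal_re, Complex.ofReal_im, mul_zero, zero_add, Complex.mul_im,
      Complex.ofReal_re, Complex.ofReal_im, zero_mul, add_zero, Complex.im_sum]
    simp_rw [hχ]
  -- norms of the parts
  have hG0 : (0 : ℝ) ≤ Nat.card (N ≃ₐ[ℚ] N) := Nat.cast_nonneg _
  have hW0 : 0 ≤ offsetLogIntegral x + θ * offsetLogIntegral (x ^ β₁) := by
    -- the weight is nonnegative: read it off the real estimate for the constant class function `1`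
    have h1' := hS (fun _ => (1 : ℝ)) (fun _ _ => rfl) Fr hFr x hx
    have hpos : 0 < (∑ _g : N ≃ₐ[ℚ] N, |(1 : ℝ)|) := by
      rw [Finset.sum_const, nsmul_eq_mul, abs_one, mul_one]
      exact_mod_cast Finset.card_pos.mpr ⟨1, Finset.mem_univ _⟩
    have hGpos : (0 : ℝ) < Nat.card (N ≃ₐ[ℚ] N) := by
      have : 0 < Nat.card (N ≃ₐ[ℚ] N) := Nat.card_pos
      exact_mod_cast this
    have h2 : 0 ≤ ε * ((∑ _g : N ≃ₐ[ℚ] N, |(1 : ℝ)|) *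
        (offsetLogIntegral x + θ * offsetLogIntegral (x ^ β₁)) / Nat.card (N ≃ₐ[ℚ] N)) :=
      le_trans (abs_nonneg _) h1'
    have h3 : ε * ((∑ _g : N ≃ₐ[ℚ] N, |(1 : ℝ)|) *
        (offsetLogIntegral x + θ * offsetLogIntegral (x ^ β₁)) / Nat.card (N ≃ₐ[ℚ] N)) =
        (ε * (∑ _g : N ≃ₐ[ℚ] N, |(1 : ℝ)|) / Nat.card (N ≃ₐ[ℚ] N)) *
          (offsetLogIntegral x + θ * offsetLogIntegral (x ^ β₁)) := by ring
    have h4 : 0 < ε * (∑ _g : N ≃ₐ[ℚ] N, |(1 : ℝ)|) / Nat.card (N ≃ₐ[ℚ] N) := by positivity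
    rw [h3] at h2
    exact (mul_nonneg_iff_of_pos_left h4).mp h2
  have hsum_re : (∑ g : N ≃ₐ[ℚ] N, |(φ g).re|) ≤ ∑ g : N ≃ₐ[ℚ] N, ‖φ g‖ :=
    Finset.sum_le_sum fun g _ => Complex.abs_re_le_norm (φ g)
  have hsum_im : (∑ g : N ≃ₐ[ℚ] N, |(φ g).im|) ≤ ∑ g : N ≃ₐ[ℚ] N, ‖φ g‖ :=
    Finset.sum_le_sum fun g _ => Complex.abs_im_le_norm (φ g)
  have hre' : |E.re| ≤ ε * ((∑ g : N ≃ₐ[ℚ] N, ‖φ g‖) *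
      (offsetLogIntegral x + θ * offsetLogIntegral (x ^ β₁)) / Nat.card (N ≃ₐ[ℚ] N)) := by
    rw [hEre]
    refine hre.trans ?_
    apply mul_le_mul_of_nonneg_left _ hε.le
    apply div_le_div_of_nonneg_right _ hG0
    exact mul_le_mul_of_nonneg_right hsum_re hW0
  have him' : |E.im| ≤ ε * ((∑ g : N ≃ₐ[ℚ] N, ‖φ g‖) *
      (offsetLogIntegral x + θ * offsetLogIntegral (x ^ β₁)) / Nat.card (N ≃ₐ[ℚ] N)) := by
    rw [hEim]
    refine him.trans ?_
    apply mul_le_mul_of_nonneg_left _ hε.le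
    apply div_le_div_of_nonneg_right _ hG0
    exact mul_le_mul_of_nonneg_right hsum_im hW0
  calc ‖E‖ ≤ |E.re| + |E.im| := Complex.norm_le_abs_re_add_abs_im E
    _ ≤ _ := by linarith

end Summit.QuantumAdvantage.QuantumAdvantage.Theorems.DegreeOnePrimesEscape

end
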